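import Literature.MathematicalPhysics.QuantumFieldTheory.Balaban1983to89.B5SmoothPartition

/-!
# `Balaban1983to89.B9Eq387ProductPartitionBondEnergy` — T. Bałaban, *Propagators and renormalization transformations for lattice gauge theories. I*,
# Commun. Math. Phys. **95** (1984) 17–40 [Balaban1984PropagatorsI] (1.118) p. 36 («h_z(x) = Π_μ h((x_μ − z_μ)∕M₀) … Σ_z h_z²(x) = 1») with T. Bałaban,
# *Propagators for lattice gauge theories in a background field*, Commun. Math. Phys. **99** (1985) 389–434 [Balaban1985BackgroundPropagators] p. 408
# «Σ_{□∈𝒟} h²_□ = 1», p. 414 «O(M⁻¹), or O(M⁻²)»: **THE `Θ₂` LETTER OF THE IMS LOCALISATION IS ONE-DIMENSIONAL FOR PRODUCT PARTITIONS — for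
# `χ_z(x) = Π_i h_i(z_i, x_i)` with `Σ_k h_i(k, t)² = 1` per coordinate, a pair `x, y` differing in ONE coordinate `μ` has
# `Σ_z (χ_z(x) − χ_z(y))² = Σ_k (h_μ(k, x_μ) − h_μ(k, y_μ))²` EXACTLY (no `d`, no overlap count), arbitrary pairs are subadditive over the
# coordinates, and for the tree's `C^{1,1}` partition `B5SmoothPartition.hS` lattice neighbours have `Σ_z (hS_z(x) − hS_z(y))² ≤ 64∕M₀²`** —
# route R2′ STEP B8′ of the pub-balaban NE9 chain, the number behind rows L1∕L6∕L7 of the instance ledger (`t4/ROUTES-NE9.md` v13.30–v13.32)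

statement-level skeleton of published theorems with citation tags; proofs where landed; nothing here is a claim about the Yang–Mills mass gap

CITATION HEADER (lean-in-tree rule).  Audit cell `pub-balaban`, sub-cell `t4`, BINDER row NE9; filed by NE9 formalisation-swarm LEAF PROVER 01
(`b2b-balaban-t4-ne9-formalise-leaf-01`, gen 81) as the PORT of the NE9 crux-ideation seat's KERNEL 9 `t4/ideate/NE9/lens1-NE9ProductPartitionBondEnergy.lean`
(t4-ne9-idea-1 gen 95, sha16 86705a92fa11ad59; scratch, never proposed — CREDIT: every statement and every proof below is the kernel's, VERBATIM up to the
namespace, the `private` marking of the §1–§2 helpers, the citation tags and this header; OFFER O-idea1-g95-1, journal [NE9IDEA1-G95-WORDS] l.48953, first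
refusal this lineage as the IMS porter — `B9Eq387QuadraticPartitionIMS` ∕ `B9Eq387IMSAssembly` — whose lattice instance consumes `Θ₂`).  Consumers BY NAME:
ne9-leaf-04's `B9Eq3100LeibnizCommutatorCurl` ∕ `…Div` ∕ `…EtaFree` (hypotheses `hχ : Σ_j (χ_j(b₋) − χ_j(b₊))² ≤ Θ₂`).  Sources READ: [B5′] (1.118) p. 36 as
quoted (in full, certified) in the cell's `B5SmoothPartition` ∕ `B5TorusPartition` ∕ `B5Local114` headers (lit-balaban b05 gen 5); [B9] pp. 408, 414 in the held
text (`paper:balaban1985-cmp99-background-propagators`, journal page = PDF page + 388).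

THE PRINT (verbatim).  [B5′] p. 36: *«We construct a partition of unity taking the functions h_z(x) = Π_{μ=1}^d h((x_μ − z_μ)/M₀), h ∈ C₀^∞(]−⅔, ⅔[),
h(t) = 1 for t ∈ [−⅓, ⅓], h is chosen in such a way that Σ_n h²(t − n) = 1, hence Σ_z h_z²(x) = 1. (1.118)»*  [B9] p. 408: *«We take the partition of
unity {h_□} defined at the end of Sect. A in [4]. We have Σ_{□∈𝒟} h²_□ = 1.»*; p. 414 l.1–3: the commutators with `h` *«are first order differential operators
with coefficients determined by derivatives of the function h. They are of the order O(M⁻¹), or O(M⁻²), if considered on a proper scale.»*  Print never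
isolates the bond energy `Σ_z (h_z(x) − h_z(y))²`; the tree's route (ROUTES-NE9 §L1.2 R2′ STEP B8′, kernel 7 = `B9Eq387IMSAssembly`) consumes it as the
letter `Θ₂`, and THIS file shows that for the PRINTED product shape it is a one-dimensional quantity: `Θ₂ ≤ 64∕M₀²` for the tree's partition, against the
naive Lipschitz-times-overlap bookkeeping `2·2^d·(4d∕M₀)²` (a factor 128 at `d = 4`).  Nothing of [B5′]∕[B9] is asserted.

WHAT IS PROVED (sorry-free; 0 `def`; axioms standard; [folklore] throughout).
* §1–§2 (private helpers): `|⟨u, v⟩| ≤ 1` and the chord identity `Σ(u − v)² = 2 − 2⟨u, v⟩` for unit families; `1 − Π_i a_i ≤ Σ_i (1 − a_i)` on `[−1, 1]`.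
* §3 PRODUCT FAMILIES over a finite coordinate index: `sum_prod_mul_prod` (`Σ_z Π f·Π g = Π_i Σ_k f g`), `sum_prod_sq`, `sum_prod_sub_prod_sq`,
  **`sum_prod_sub_prod_sq_le`** (MAIN 1, subadditivity: `Σ_z (Π f − Π g)² ≤ Σ_i Σ_k (f_i − g_i)²` for unit 1-D families), **`sum_prod_sub_prod_sq_eq_of_eq_off`**
  (MAIN 2, exact one-dimensionality when `f_i = g_i` off `μ`).
* §4 `sum_sub_sq_le_card_mul_sq` (the 1-D letter `≤ #S·ℓ²`).
* §5 product partitions `χ_z(x) = Π_i h_i(z_i, x_i)`: `bondEnergy_eq_oneDim`, `bondEnergy_le_sum_oneDim`, `bondEnergy_le_card_mul_sq`.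
* §6 THE INSTANCE on the tree's `B5SmoothPartition.hS N M₀` over `B4Sect5Torus.TSite d N` (= the NE9 chain's site type) under `1 ≤ M₀`, `M₀ ∣ N_i`, `2M₀ ≤ N_i`:
  `sum_hS_sub_sq_eq`, `sum_hS_sub_sq_le_sum`, `exists_support_gS_pair` (at most 4 profiles see a pair), `sum_hS_sub_sq_le` (`≤ 4·(4r∕M₀)²` at circular
  offset `r`), **`sum_hS_sub_sq_le_of_neighbour`** (`Θ₂ ≤ 64∕M₀²` for lattice neighbours — uniformly in `d`, the torus and the position); non-vacuity `example`.
HONEST SCOPE.  The `η`-dictionary (`M₀ = M∕η`, `c = η⁻¹`: `‖c‖²Θ₂ ≤ 64∕M²`) and the `WL2` multiplication operators are NOT here (ne9-leaf-04's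
`B9Eq3100LeibnizCommutatorEtaFree`, ne9-leaf-06's `B9Eq311PointwiseMultipliers`); no estimate of [B9] is asserted.  NOT NE9, NOT the route (cell pub-balaban:
NE9 NOT PRINTED ∕ NOT PROVED; «NE9 ⇐ the named binders»; row WALLED ON A MODEL (O-NE9-1; #5 UNRULED); spine PROVED 0∕9; rung (B)+1 on a finite T⁴ — NOT infinite
volume, NOT mass gap, NOT Clay; HONEST DEPENDENCY: continuum YM on T⁴ ⇐ BetaPertH ∧ nine spine estimates (0/9 proved); BetaPertH ⇐ (D1) ∧ (D4) ∧ CAP+tail;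
G-an2-4 gates asym, D1 and NE2/3/4).  NEW file importing the cell's `B5SmoothPartition` only; nothing modified.  Net new unproved facts: 0.
-/

noncomputable section

namespace Literature.MathematicalPhysics.QuantumFieldTheory.Balaban1983to89.B9Eq387ProductPartitionBondEnergy

open Finset
open scoped BigOperators

/-! ## §1 Unit families in `ℝ^J`: `|⟨u, v⟩| ≤ 1` and the chord identity -/

section Unit

variable {J : Type*} [Fintype J]

/-- `2⟨u, v⟩ ≤ ‖u‖² + ‖v‖²`. [folklore] -/
private theorem two_mul_sum_mul_le (u v : J → ℝ) :
    2 * ∑ j, u j * v j ≤ ∑ j, u j ^ 2 + ∑ j, v j ^ 2 := by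
  rw [Finset.mul_sum, ← Finset.sum_add_distrib]
  exact Finset.sum_le_sum fun j _ => by nlinarith [sq_nonneg (u j - v j)]

/-- `⟨u, v⟩ ≤ 1` for unit families. [folklore] -/
private theorem sum_mul_le_one {u v : J → ℝ} (hu : ∑ j, u j ^ 2 = 1) (hv : ∑ j, v j ^ 2 = 1) :
    ∑ j, u j * v j ≤ 1 := by
  have h := two_mul_sum_mul_le u v
  rw [hu, hv] at h
  linarith

/-- `−1 ≤ ⟨u, v⟩` for unit families. [folklore] -/
private theorem neg_one_le_sum_mul {u v : J → ℝ} (hu : ∑ j, u j ^ 2 = 1) (hv : ∑ j, v j ^ 2 = 1) :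
    -1 ≤ ∑ j, u j * v j := by
  have h := two_mul_sum_mul_le (fun j => -u j) v
  have e1 : ∑ j, (fun j => -u j) j ^ 2 = ∑ j, u j ^ 2 := Finset.sum_congr rfl fun j _ => by ring
  have e2 : ∑ j, (fun j => -u j) j * v j = -∑ j, u j * v j := by
    rw [← Finset.sum_neg_distrib]; exact Finset.sum_congr rfl fun j _ => by ring
  rw [e1, e2, hu, hv] at h
  linarith

/-- THE CHORD IDENTITY `Σ (u − v)² = 2 − 2⟨u, v⟩` for unit families. [folklore] -/
private theorem sum_sub_sq_eq {u v : J → ℝ} (hu : ∑ j, u j ^ 2 = 1) (hv : ∑ j, v j ^ 2 = 1) :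
    ∑ j, (u j - v j) ^ 2 = 2 - 2 * ∑ j, u j * v j := by
  have h : ∀ j, (u j - v j) ^ 2 = u j ^ 2 + v j ^ 2 - 2 * (u j * v j) := fun j => by ring
  simp_rw [h, Finset.sum_sub_distrib, Finset.sum_add_distrib, ← Finset.mul_sum, hu, hv]
  ring

end Unit

/-! ## §2 `1 − Π a ≤ Σ (1 − a)` on `[−1, 1]` -/

section OneSubProd

variable {ι : Type*}

/-- `|Π a| ≤ 1` if every `|a_i| ≤ 1`. [folklore] -/
private theorem abs_prod_le_one (s : Finset ι) {a : ι → ℝ} (h : ∀ i ∈ s, |a i| ≤ 1) : |∏ i ∈ s, a i| ≤ 1 := by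
  rw [Finset.abs_prod]
  exact Finset.prod_le_one (fun i _ => abs_nonneg _) h

/-- `1 − Π_{i∈s} a_i ≤ Σ_{i∈s} (1 − a_i)` whenever every `|a_i| ≤ 1` (induction: `(1 − a)(1 − P) ≥ 0`). [folklore] -/
private theorem one_sub_prod_le_sum (s : Finset ι) {a : ι → ℝ} (h : ∀ i ∈ s, |a i| ≤ 1) :
    1 - ∏ i ∈ s, a i ≤ ∑ i ∈ s, (1 - a i) := by
  classical
  revert h
  refine Finset.induction_on s (by simp) ?_
  intro i s hi ih h
  rw [Finset.prod_insert hi, Finset.sum_insert hi]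
  have hs : ∀ j ∈ s, |a j| ≤ 1 := fun j hj => h j (Finset.mem_insert_of_mem hj)
  have hP : ∏ j ∈ s, a j ≤ 1 := (abs_le.1 (abs_prod_le_one s hs)).2
  have ha : a i ≤ 1 := (abs_le.1 (h i (Finset.mem_insert_self i s))).2
  have ih' := ih hs
  nlinarith [mul_nonneg (sub_nonneg.2 ha) (sub_nonneg.2 hP)]

end OneSubProd

/-! ## §3 Product families over a finite coordinate index: `Σ_z Π f · Π g = Π_i Σ_k f g` and the two MAIN statements -/

section Product

variable {ι : Type*} [Fintype ι] [DecidableEq ι] {κ : ι → Type*} [∀ i, Fintype (κ i)]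

/-- `Σ_z (Π_i f_i(z_i))(Π_i g_i(z_i)) = Π_i Σ_k f_i(k) g_i(k)` — the tensor-product inner product of product families (the shape `h_z(x) = Π_μ h((x_μ − z_μ)∕M₀)` of (1.118)). [folklore] [cite: Balaban1984PropagatorsI, (1.118) p.36] -/
theorem sum_prod_mul_prod (f g : ∀ i, κ i → ℝ) :
    ∑ z : (∀ i, κ i), (∏ i, f i (z i)) * ∏ i, g i (z i) = ∏ i, ∑ k, f i k * g i k := by
  rw [Fintype.prod_sum]
  simp_rw [Finset.prod_mul_distrib]

/-- `Σ_z (Π_i f_i(z_i))² = Π_i Σ_k f_i(k)²` («hence Σ_z h_z²(x) = 1» coordinate by coordinate). [folklore] [cite: Balaban1984PropagatorsI, (1.118) p.36] -/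
theorem sum_prod_sq (f : ∀ i, κ i → ℝ) :
    ∑ z : (∀ i, κ i), (∏ i, f i (z i)) ^ 2 = ∏ i, ∑ k, f i k ^ 2 := by
  simp_rw [sq]
  exact sum_prod_mul_prod f f

/-- Expansion of the product chord energy `Σ_z (Π f − Π g)²`. [folklore] [cite: Balaban1984PropagatorsI, (1.118) p.36] -/
theorem sum_prod_sub_prod_sq (f g : ∀ i, κ i → ℝ) :
    ∑ z : (∀ i, κ i), (∏ i, f i (z i) - ∏ i, g i (z i)) ^ 2
      = ∏ i, ∑ k, f i k ^ 2 + ∏ i, ∑ k, g i k ^ 2 - 2 * ∏ i, ∑ k, f i k * g i k := by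
  have h : ∀ z : (∀ i, κ i), (∏ i, f i (z i) - ∏ i, g i (z i)) ^ 2
      = (∏ i, f i (z i)) ^ 2 + (∏ i, g i (z i)) ^ 2 - 2 * ((∏ i, f i (z i)) * ∏ i, g i (z i)) :=
    fun z => by ring
  simp_rw [h, Finset.sum_sub_distrib, Finset.sum_add_distrib, ← Finset.mul_sum, sum_prod_sq, sum_prod_mul_prod]

/-- **MAIN 1 — SUBADDITIVITY OVER COORDINATES.**  For unit 1-D families `Σ_k f_i(k)² = Σ_k g_i(k)² = 1`,
`Σ_z (Π f_i(z_i) − Π g_i(z_i))² ≤ Σ_i Σ_k (f_i(k) − g_i(k))²`. [folklore] [cite: Balaban1984PropagatorsI, (1.118) p.36; Balaban1985BackgroundPropagators, p.408] -/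
theorem sum_prod_sub_prod_sq_le {f g : ∀ i, κ i → ℝ} (hf : ∀ i, ∑ k, f i k ^ 2 = 1)
    (hg : ∀ i, ∑ k, g i k ^ 2 = 1) :
    ∑ z : (∀ i, κ i), (∏ i, f i (z i) - ∏ i, g i (z i)) ^ 2 ≤ ∑ i, ∑ k, (f i k - g i k) ^ 2 := by
  rw [sum_prod_sub_prod_sq]
  simp_rw [hf, hg, Finset.prod_const_one]
  have hchord : ∀ i, ∑ k, (f i k - g i k) ^ 2 = 2 - 2 * ∑ k, f i k * g i k :=
    fun i => sum_sub_sq_eq (hf i) (hg i)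
  simp_rw [hchord]
  have habs : ∀ i ∈ (Finset.univ : Finset ι), |∑ k, f i k * g i k| ≤ 1 := fun i _ =>
    abs_le.2 ⟨neg_one_le_sum_mul (hf i) (hg i), sum_mul_le_one (hf i) (hg i)⟩
  have key := one_sub_prod_le_sum Finset.univ habs
  have h2 : ∑ i, (2 - 2 * ∑ k, f i k * g i k) = 2 * ∑ i, (1 - ∑ k, f i k * g i k) := by
    rw [Finset.mul_sum]
    exact Finset.sum_congr rfl fun i _ => by ring
  rw [h2]
  linarith

/-- **MAIN 2 — EXACT ONE-DIMENSIONALITY.**  If `g_i = f_i` for `i ≠ μ` and these are unit families, then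
`Σ_z (Π f_i(z_i) − Π g_i(z_i))² = Σ_k (f_μ(k) − g_μ(k))²`. [folklore] [cite: Balaban1984PropagatorsI, (1.118) p.36; Balaban1985BackgroundPropagators, p.408] -/
theorem sum_prod_sub_prod_sq_eq_of_eq_off {f g : ∀ i, κ i → ℝ} (μ : ι) (hfg : ∀ i, i ≠ μ → ∀ k, g i k = f i k)
    (hf : ∀ i, i ≠ μ → ∑ k, f i k ^ 2 = 1) :
    ∑ z : (∀ i, κ i), (∏ i, f i (z i) - ∏ i, g i (z i)) ^ 2 = ∑ k, (f μ k - g μ k) ^ 2 := by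
  rw [sum_prod_sub_prod_sq]
  have e1 : ∏ i, ∑ k, f i k ^ 2 = ∑ k, f μ k ^ 2 :=
    Fintype.prod_eq_single μ fun i hi => hf i hi
  have e2 : ∏ i, ∑ k, g i k ^ 2 = ∑ k, g μ k ^ 2 :=
    Fintype.prod_eq_single μ fun i hi => by
      rw [Finset.sum_congr rfl fun k _ => by rw [hfg i hi k]]; exact hf i hi
  have e3 : ∏ i, ∑ k, f i k * g i k = ∑ k, f μ k * g μ k :=
    Fintype.prod_eq_single μ fun i hi => by
      rw [Finset.sum_congr rfl fun k _ => by rw [hfg i hi k]]; simpa only [sq] using hf i hi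
  rw [e1, e2, e3]
  have h : ∀ k, (f μ k - g μ k) ^ 2 = f μ k ^ 2 + g μ k ^ 2 - 2 * (f μ k * g μ k) := fun k => by ring
  simp_rw [h, Finset.sum_sub_distrib, Finset.sum_add_distrib, ← Finset.mul_sum]

end Product

/-! ## §4 The one-dimensional letter: support count × Lipschitz -/

section OneDim

variable {K : Type*} [Fintype K]

/-- `Σ_k (a_k − b_k)² ≤ #S·ℓ²` if `|a_k − b_k| ≤ ℓ` and both families vanish off `S` (the 1-D letter: support count × Lipschitz of `h ∈ C₀^∞(]−⅔, ⅔[)`). [folklore] [cite: Balaban1984PropagatorsI, (1.118) p.36] -/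
theorem sum_sub_sq_le_card_mul_sq (a b : K → ℝ) {ℓ : ℝ} (hℓ : ∀ k, |a k - b k| ≤ ℓ)
    (S : Finset K) (hS : ∀ k, k ∉ S → a k = 0 ∧ b k = 0) :
    ∑ k, (a k - b k) ^ 2 ≤ S.card * ℓ ^ 2 := by
  have hz : ∀ k, k ∉ S → (a k - b k) ^ 2 = 0 := fun k hk => by
    obtain ⟨h1, h2⟩ := hS k hk
    simp [h1, h2]
  have hsplit : ∑ k, (a k - b k) ^ 2 = ∑ k ∈ S, (a k - b k) ^ 2 :=
    (Finset.sum_subset (Finset.subset_univ S) fun k _ hk => hz k hk).symm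
  rw [hsplit]
  calc ∑ k ∈ S, (a k - b k) ^ 2 ≤ ∑ k ∈ S, ℓ ^ 2 :=
        Finset.sum_le_sum fun k _ => sq_le_sq.2 ((hℓ k).trans (le_abs_self ℓ))
    _ = S.card * ℓ ^ 2 := by rw [Finset.sum_const, nsmul_eq_mul]

end OneDim

/-! ## §5 Product partitions of unity `χ_z(x) = Π_i h_i(z_i, x_i)` on a product of coordinate sets -/

section Torus

variable {ι : Type*} [Fintype ι] [DecidableEq ι] {κ : ι → Type*} [∀ i, Fintype (κ i)] {T : ι → Type*}

/-- **One-coordinate pairs: the bond energy of a product partition is one-dimensional, exactly.** [folklore] [cite: Balaban1984PropagatorsI, (1.118) p.36; Balaban1985BackgroundPropagators, p.408] -/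
theorem bondEnergy_eq_oneDim (h : ∀ i, κ i → T i → ℝ) (hunit : ∀ i t, ∑ k, h i k t ^ 2 = 1)
    (x y : ∀ i, T i) (μ : ι) (hxy : ∀ i, i ≠ μ → y i = x i) :
    ∑ z : (∀ i, κ i), (∏ i, h i (z i) (x i) - ∏ i, h i (z i) (y i)) ^ 2
      = ∑ k, (h μ k (x μ) - h μ k (y μ)) ^ 2 :=
  sum_prod_sub_prod_sq_eq_of_eq_off (f := fun i k => h i k (x i)) (g := fun i k => h i k (y i)) μ
    (fun i hi k => by simp only [hxy i hi]) (fun i _ => hunit i (x i))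

/-- **Arbitrary pairs: subadditivity over coordinates.** [folklore] [cite: Balaban1984PropagatorsI, (1.118) p.36; Balaban1985BackgroundPropagators, p.408] -/
theorem bondEnergy_le_sum_oneDim (h : ∀ i, κ i → T i → ℝ) (hunit : ∀ i t, ∑ k, h i k t ^ 2 = 1)
    (x y : ∀ i, T i) :
    ∑ z : (∀ i, κ i), (∏ i, h i (z i) (x i) - ∏ i, h i (z i) (y i)) ^ 2
      ≤ ∑ i, ∑ k, (h i k (x i) - h i k (y i)) ^ 2 :=
  sum_prod_sub_prod_sq_le (f := fun i k => h i k (x i)) (g := fun i k => h i k (y i))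
    (fun i => hunit i (x i)) (fun i => hunit i (y i))

/-- **The `Θ₂` letter, d-free**: one-coordinate pair + 1-D Lipschitz + 1-D support set. [folklore] [cite: Balaban1984PropagatorsI, (1.118) p.36; Balaban1985BackgroundPropagators, p.408] -/
theorem bondEnergy_le_card_mul_sq (h : ∀ i, κ i → T i → ℝ) (hunit : ∀ i t, ∑ k, h i k t ^ 2 = 1)
    (x y : ∀ i, T i) (μ : ι) (hxy : ∀ i, i ≠ μ → y i = x i) {ℓ : ℝ}
    (hℓ : ∀ k, |h μ k (x μ) - h μ k (y μ)| ≤ ℓ) (S : Finset (κ μ))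
    (hS : ∀ k, k ∉ S → h μ k (x μ) = 0 ∧ h μ k (y μ) = 0) :
    ∑ z : (∀ i, κ i), (∏ i, h i (z i) (x i) - ∏ i, h i (z i) (y i)) ^ 2 ≤ S.card * ℓ ^ 2 := by
  rw [bondEnergy_eq_oneDim h hunit x y μ hxy]
  exact sum_sub_sq_le_card_mul_sq _ _ hℓ S hS

end Torus

/-! ## §6 INSTANCE: the tree's `C^{1,1}` partition `B5SmoothPartition.hS` on `B4Sect5Torus.TSite d N` -/

section Instance

open B4TorusKernel.MultiPeriod (circAbs circAbs_nonneg)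
open B4Sect5Torus (TSite)
open B5TorusCover (nC Ctr)
open B5TorusPartition (cdist)
open B5SmoothPartition (gS hS sum_gS_sq abs_gS_sub_le gS_eq_zero_of_le cdist_two_term)

variable {d : ℕ} {N : Fin d → ℕ}

/-- **(6a) EXACT one-dimensionality for the tree's `C^{1,1}` partition `hS`**: pairs differing in coordinate `μ` only. [folklore] [cite: Balaban1984PropagatorsI, (1.118) p.36; Balaban1985BackgroundPropagators, p.408] -/
theorem sum_hS_sub_sq_eq {M₀ : ℕ} (hM : 1 ≤ M₀) (hdiv : ∀ i, M₀ ∣ N i) (h2N : ∀ i, 2 * M₀ ≤ N i)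
    (x y : TSite d N) (μ : Fin d) (hxy : ∀ i, i ≠ μ → y i = x i) :
    ∑ z : Ctr N M₀, (hS N M₀ z x - hS N M₀ z y) ^ 2
      = ∑ k : Fin (nC (N μ) M₀), (gS (N μ) M₀ k (x μ) - gS (N μ) M₀ k (y μ)) ^ 2 := by
  unfold hS
  exact bondEnergy_eq_oneDim (κ := fun i => Fin (nC (N i) M₀)) (fun i k t => gS (N i) M₀ k t)
    (fun i t => sum_gS_sq hM (hdiv i) (h2N i) t) x y μ hxy

/-- **(6a′) SUBADDITIVITY for `hS`**, arbitrary pairs. [folklore] [cite: Balaban1984PropagatorsI, (1.118) p.36; Balaban1985BackgroundPropagators, p.408] -/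
theorem sum_hS_sub_sq_le_sum {M₀ : ℕ} (hM : 1 ≤ M₀) (hdiv : ∀ i, M₀ ∣ N i) (h2N : ∀ i, 2 * M₀ ≤ N i)
    (x y : TSite d N) :
    ∑ z : Ctr N M₀, (hS N M₀ z x - hS N M₀ z y) ^ 2
      ≤ ∑ μ, ∑ k : Fin (nC (N μ) M₀), (gS (N μ) M₀ k (x μ) - gS (N μ) M₀ k (y μ)) ^ 2 := by
  unfold hS
  exact bondEnergy_le_sum_oneDim (κ := fun i => Fin (nC (N i) M₀)) (fun i k t => gS (N i) M₀ k t)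
    (fun i t => sum_gS_sq hM (hdiv i) (h2N i) t) x y

/-- **(6b) at most FOUR profiles see a pair of residues** (two-term structure `cdist_two_term`). [folklore] [cite: Balaban1984PropagatorsI, (1.118) p.36] -/
theorem exists_support_gS_pair {N M₀ : ℕ} (hM : 1 ≤ M₀) (hdiv : M₀ ∣ N) (h2N : 2 * M₀ ≤ N) (t t' : Fin N) :
    ∃ S : Finset (Fin (nC N M₀)), S.card ≤ 4 ∧
      ∀ k, k ∉ S → gS N M₀ k t = 0 ∧ gS N M₀ k t' = 0 := by
  classical
  obtain ⟨k₀, k₁, -, -, -, hk⟩ := cdist_two_term hM hdiv h2N t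
  obtain ⟨k₀', k₁', -, -, -, hk'⟩ := cdist_two_term hM hdiv h2N t'
  refine ⟨{k₀, k₁, k₀', k₁'}, Finset.card_le_four, ?_⟩
  intro k hk
  simp only [Finset.mem_insert, Finset.mem_singleton, not_or] at hk
  obtain ⟨h0, h1, h0', h1'⟩ := hk
  exact ⟨gS_eq_zero_of_le hM (hk k h0 h1), gS_eq_zero_of_le hM (hk' k h0' h1')⟩

/-- **(6c) THE d-FREE LETTER for `hS`**: one-coordinate pairs at circular offset `r = circAbs(x_μ − y_μ)`:
`Σ_z (hS z x − hS z y)² ≤ 4·(4r∕M₀)²`. [folklore] [cite: Balaban1984PropagatorsI, (1.118) p.36; Balaban1985BackgroundPropagators, p.408] -/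
theorem sum_hS_sub_sq_le {M₀ : ℕ} (hM : 1 ≤ M₀) (hdiv : ∀ i, M₀ ∣ N i) (h2N : ∀ i, 2 * M₀ ≤ N i)
    (x y : TSite d N) (μ : Fin d) (hxy : ∀ i, i ≠ μ → y i = x i) :
    ∑ z : Ctr N M₀, (hS N M₀ z x - hS N M₀ z y) ^ 2
      ≤ 4 * (4 / (M₀ : ℝ) * (circAbs (N μ) (((x μ).val : ℤ) - ((y μ).val : ℤ)) : ℝ)) ^ 2 := by
  classical
  have hN : 1 ≤ N μ := by have := h2N μ; omega
  obtain ⟨S, hS4, hS0⟩ := exists_support_gS_pair hM (hdiv μ) (h2N μ) (x μ) (y μ)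
  rw [sum_hS_sub_sq_eq hM hdiv h2N x y μ hxy]
  calc ∑ k, (gS (N μ) M₀ k (x μ) - gS (N μ) M₀ k (y μ)) ^ 2
      ≤ S.card * (4 / (M₀ : ℝ) * (circAbs (N μ) (((x μ).val : ℤ) - ((y μ).val : ℤ)) : ℝ)) ^ 2 :=
        sum_sub_sq_le_card_mul_sq _ _ (fun k => abs_gS_sub_le hN hM k (x μ) (y μ)) S hS0
    _ ≤ 4 * (4 / (M₀ : ℝ) * (circAbs (N μ) (((x μ).val : ℤ) - ((y μ).val : ℤ)) : ℝ)) ^ 2 := by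
        have h4 : (S.card : ℝ) ≤ 4 := by exact_mod_cast hS4
        exact mul_le_mul_of_nonneg_right h4 (sq_nonneg _)

/-- **(6d) LATTICE NEIGHBOURS: `Θ₂ ≤ 64∕M₀²`** — uniformly in `d`, the torus and the position (the `Θ₂` hypothesis of `B9Eq3100LeibnizCommutatorCurl∕Div` for the tree's partition; [B9] p. 414 «O(M⁻²)»). [folklore] [cite: Balaban1984PropagatorsI, (1.118) p.36; Balaban1985BackgroundPropagators, p.408, p.414] -/
theorem sum_hS_sub_sq_le_of_neighbour {M₀ : ℕ} (hM : 1 ≤ M₀) (hdiv : ∀ i, M₀ ∣ N i) (h2N : ∀ i, 2 * M₀ ≤ N i)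
    (x y : TSite d N) (μ : Fin d) (hxy : ∀ i, i ≠ μ → y i = x i)
    (hnb : (circAbs (N μ) (((x μ).val : ℤ) - ((y μ).val : ℤ)) : ℝ) ≤ 1) :
    ∑ z : Ctr N M₀, (hS N M₀ z x - hS N M₀ z y) ^ 2 ≤ 64 / (M₀ : ℝ) ^ 2 := by
  have hN : 1 ≤ N μ := by have := h2N μ; omega
  have hM' : (0 : ℝ) < M₀ := by exact_mod_cast (show 0 < M₀ by omega)
  have hc0 : (0 : ℝ) ≤ (circAbs (N μ) (((x μ).val : ℤ) - ((y μ).val : ℤ)) : ℝ) := by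
    exact_mod_cast circAbs_nonneg hN _
  have h := sum_hS_sub_sq_le hM hdiv h2N x y μ hxy
  have hc1 : 4 / (M₀ : ℝ) * (circAbs (N μ) (((x μ).val : ℤ) - ((y μ).val : ℤ)) : ℝ) ≤ 4 / (M₀ : ℝ) := by
    simpa using mul_le_mul_of_nonneg_left hnb (by positivity : (0 : ℝ) ≤ 4 / (M₀ : ℝ))
  have hc0' : 0 ≤ 4 / (M₀ : ℝ) * (circAbs (N μ) (((x μ).val : ℤ) - ((y μ).val : ℤ)) : ℝ) :=
    mul_nonneg (by positivity) hc0
  have hsq := pow_le_pow_left₀ hc0' hc1 2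
  calc ∑ z : Ctr N M₀, (hS N M₀ z x - hS N M₀ z y) ^ 2
      ≤ 4 * (4 / (M₀ : ℝ) * (circAbs (N μ) (((x μ).val : ℤ) - ((y μ).val : ℤ)) : ℝ)) ^ 2 := h
    _ ≤ 4 * (4 / (M₀ : ℝ)) ^ 2 := mul_le_mul_of_nonneg_left hsq (by norm_num)
    _ = 64 / (M₀ : ℝ) ^ 2 := by ring

/-- Non-vacuity: the side conditions are jointly satisfiable (`d = 1`, `N = 2`, `M₀ = 1`, `y = x`). [folklore] [cite: Balaban1984PropagatorsI, (1.118) p.36] -/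
example (x : TSite 1 (fun _ => 2)) :
    ∑ z : Ctr (fun _ : Fin 1 => 2) 1, (hS (fun _ : Fin 1 => 2) 1 z x - hS (fun _ : Fin 1 => 2) 1 z x) ^ 2
      ≤ 64 / ((1 : ℕ) : ℝ) ^ 2 :=
  sum_hS_sub_sq_le_of_neighbour (μ := 0) le_rfl (fun _ => one_dvd _) (fun _ => le_rfl) x x
    (fun _ _ => rfl) (by simp [circAbs])

end Instance

end Literature.MathematicalPhysics.QuantumFieldTheory.Balaban1983to89.B9Eq387ProductPartitionBondEnergy

end
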